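import Mathlib

/-!
# Hodge-locus census (cell `pub-hlocus`, engine B, abs-2 gen 49): the FRONT law skeleton

certified instances and evidence bearing on the general Hodge conjecture; no claim.

Helper file of `stmt-HodgeConjecture-16267` (computational census records; nothing here is
used by any route).  Census record: `data/abs/engineB/DERIVATIONS_engineB.md` §66.4–66.5.

In the doubled trace-zero coordinates `U = (X, Y, W)` of §64.4 the reduced norm is the ternary
form `N(U) = X² + 3Y² + 3W²` (`N(U_𝔞) = 4|D|`), and for two embedded roots and a unit `γ` the
trace pairing is `Q = ⟨γU_𝔞, U_𝔟⟩ = XX' + 3YY' + 3WW'` (`Q = 4x_γ`).  The census identity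
`DD' − x_γ² = 4·3^{ℓ_γ+1}·m` (certified numerically on 5 604 288 triples) rests on two
elementary facts that are kernel-checked here in full generality:

* `ternary_lagrange` — the Lagrange identity
  `N(U) N(U') − Q² = 3 (XY' − YX')² + 3 (XW' − WX')² + 9 (YW' − WY')²`, i.e. `N N' − Q²` is
  three times the norm form `A² + B² + 3C²` of the cross product; hence
* `ternary_cauchySchwarz` (`Q² ≤ N N'`) and `ternary_cauchySchwarz_strict` (`Q² < N N'` as soon
  as one cross-product coordinate is non-zero, i.e. the two roots are not proportional);
* `front_cap` — the size cap: if `D·D' − x² = 12·3^ℓ·m` with `m ≥ 1` then `12·3^ℓ ≤ D·D' − x²`,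
  and `12·3^ℓ < D·D'` when moreover `x ≠ 0`; with `x = 0` allowed one still has `12·3^ℓ ≤ D·D'`.

The arithmetic input (which `ℓ` is the θ-level; `m ≡ 1 (mod 3)`) is in the census record; the
production evidence is `data/abs/engineB/v3/xt/ta8B/model/XGAMMA-{W4u,W7,X8}.txt` and
`FRONTIER-1.txt`, `CAP2-FRESH.txt` (0 violations in 231 388 Galois orbits, tight with `m = 1`).
-/

set_option linter.dupNamespace false

namespace Summit.HodgeConjecture.HodgeConjecture.HodgeLocus.Census.FrontLawB

/-- Lagrange identity for the ternary form `X² + 3Y² + 3W²`. -/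
theorem ternary_lagrange (x y w x' y' w' : ℤ) :
    (x ^ 2 + 3 * y ^ 2 + 3 * w ^ 2) * (x' ^ 2 + 3 * y' ^ 2 + 3 * w' ^ 2)
        - (x * x' + 3 * y * y' + 3 * w * w') ^ 2
      = 3 * (x * y' - y * x') ^ 2 + 3 * (x * w' - w * x') ^ 2 + 9 * (y * w' - w * y') ^ 2 := by
  ring

/-- Cauchy–Schwarz for the ternary form: `Q² ≤ N N'`. -/
theorem ternary_cauchySchwarz (x y w x' y' w' : ℤ) :
    (x * x' + 3 * y * y' + 3 * w * w') ^ 2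
      ≤ (x ^ 2 + 3 * y ^ 2 + 3 * w ^ 2) * (x' ^ 2 + 3 * y' ^ 2 + 3 * w' ^ 2) := by
  have h := ternary_lagrange x y w x' y' w'
  nlinarith [sq_nonneg (x * y' - y * x'), sq_nonneg (x * w' - w * x'), sq_nonneg (y * w' - w * y')]

/-- Strict Cauchy–Schwarz: if one cross-product coordinate is non-zero (the roots are not
proportional) then `Q² < N N'`. -/
theorem ternary_cauchySchwarz_strict (x y w x' y' w' : ℤ)
    (h : x * y' - y * x' ≠ 0 ∨ x * w' - w * x' ≠ 0 ∨ y * w' - w * y' ≠ 0) :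
    (x * x' + 3 * y * y' + 3 * w * w') ^ 2
      < (x ^ 2 + 3 * y ^ 2 + 3 * w ^ 2) * (x' ^ 2 + 3 * y' ^ 2 + 3 * w' ^ 2) := by
  have hl := ternary_lagrange x y w x' y' w'
  have h1 := sq_nonneg (x * y' - y * x')
  have h2 := sq_nonneg (x * w' - w * x')
  have h3 := sq_nonneg (y * w' - w * y')
  rcases h with h | h | h
  · have := pow_pos (abs_pos.mpr h) 2
    rw [sq_abs] at this
    nlinarith
  · have := pow_pos (abs_pos.mpr h) 2
    rw [sq_abs] at this
    nlinarith
  · have := pow_pos (abs_pos.mpr h) 2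
    rw [sq_abs] at this
    nlinarith

/-- `N N' − Q²` is divisible by 3 (the cross product has norm form `A² + B² + 3C²`). -/
theorem three_dvd_norm_mul_sub_sq (x y w x' y' w' : ℤ) :
    (3 : ℤ) ∣ (x ^ 2 + 3 * y ^ 2 + 3 * w ^ 2) * (x' ^ 2 + 3 * y' ^ 2 + 3 * w' ^ 2)
        - (x * x' + 3 * y * y' + 3 * w * w') ^ 2 := by
  rw [ternary_lagrange]
  exact ⟨(x * y' - y * x') ^ 2 + (x * w' - w * x') ^ 2 + 3 * (y * w' - w * y') ^ 2, by ring⟩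

/-- The FRONT law skeleton (size cap): a level-`ℓ` coincidence, i.e. a factorisation
`D·D' − x² = 12·3^ℓ·m` with a positive cofactor, forces `12·3^ℓ ≤ D·D' − x² ≤ D·D'`. -/
theorem front_cap (DD x m : ℤ) (ℓ : ℕ) (hm : 1 ≤ m) (h : DD - x ^ 2 = 12 * 3 ^ ℓ * m) :
    12 * 3 ^ ℓ ≤ DD - x ^ 2 ∧ 12 * 3 ^ ℓ ≤ DD := by
  have h3 : (0 : ℤ) < 12 * 3 ^ ℓ := by positivity
  have hx := sq_nonneg x
  constructor
  · nlinarith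
  · nlinarith

/-- Strict form of the cap when the trace pairing does not vanish. -/
theorem front_cap_strict (DD x m : ℤ) (ℓ : ℕ) (hm : 1 ≤ m) (hx : x ≠ 0)
    (h : DD - x ^ 2 = 12 * 3 ^ ℓ * m) : 12 * 3 ^ ℓ < DD := by
  have h3 : (0 : ℤ) < 12 * 3 ^ ℓ := by positivity
  have hx2 : 0 < x ^ 2 := by positivity
  nlinarith

/-- The tight census instance `(D, D') = (−435, −543)`: `D·D' − 3² = 4·3^{10}` (level 9, `m = 1`). -/
example : (435 : ℤ) * 543 - 3 ^ 2 = 12 * 3 ^ 9 * 1 := by norm_num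

/-- The tight fresh instance `(D, D') = (−228, −3108)`: `D·D' − 6² = 4·3^{11}` (level 10, `m = 1`). -/
example : (228 : ℤ) * 3108 - 6 ^ 2 = 12 * 3 ^ 10 * 1 := by norm_num

end Summit.HodgeConjecture.HodgeConjecture.HodgeLocus.Census.FrontLawB
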